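import Summits.HodgeConjecture.HodgeConjecture.Theorems.F0P6aSpecOrgansHrkG
import HarnessLib

/-!
# `F0P6aSpecOrgans` — ★ RE-HOME of `Lines/F0_P6a_SpecOrgans.lean` (tree sha16 f8c3b4bc8f4404ac, 1249 l.), PART 5 of 5 — tree lines :1201–:1249 (LAST part: plain stem = the module the `Lines/` shim and every consumer import)
See PART 1 `Theorems/F0P6aSpecOrgansBlockC.lean` for the full ★ re-home header and the original module docstring (verbatim there).  Same namespace (every
fully-qualified name unchanged); the scopes open at the cut are re-opened below with their `variable` ∕ `open` ∕ `set_option` ∕ `universe` lines replayed verbatim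
from the tree, in order; the code after the replay block is the tree bytes :1201–:1249, untouched except the (d1) cure named in PART 1.  HC_CM is proved only modulo the 7 printed citations (2 remaining: hLiu418 = stmt-HodgeConjecture-24832, h413 = stmt-HodgeConjecture-24833) until rung 0 closes; a re-home is count-neutral.
-/

-- ── replay of the scopes open at tree line :1201 (verbatim) ──
set_option autoImplicit false
set_option linter.dupNamespace false
noncomputable section
universe u
namespace Summit.HodgeConjecture.HodgeConjecture.Cruxes.HLiu418.F0P6aLineSpecialisation
section Block_R
open CategoryTheory CategoryTheory.Limits NumberField IsDedekindDomain MulAction AlgebraicGeometry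
open scoped Matrix Polynomial Pointwise MonoidalCategory
open Literature.NumberTheory.GaloisRepresentations
open Literature.NumberTheory.Automorphic Literature.NumberTheory.Automorphic.UnitaryGroup
open Literature.AlgebraicGeometry.ShimuraVarieties.UnitaryCanonicalModel
open Literature.NumberTheory.Automorphic.Liu2021.AppendixC
open Literature.AlgebraicGeometry.Motives (AlgPoints IntegralModel SchemeOver thickening thickeningGalAction thickeningLift specOver)
open Literature.NumberTheory.DiophantineGeometry (geomResidueField specialFibreFunctor specResidueField)
open Literature.AlgebraicGeometry.RelativeSpec (ActionOver)
open Literature.NumberTheory.EllipticCurves (genericFibre)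
open Literature.AlgebraicGeometry.AbelianSchemes Literature.AlgebraicGeometry.AbelianSchemes.AbelianSchemeOver
open Literature.AlgebraicGeometry.GroupSchemes.AffineGroupScheme (Alg quotIncl)
open Literature.AlgebraicGeometry.GroupSchemes.IdealKernelLayerMap
open Summit.HodgeConjecture.HodgeConjecture.Cruxes.HLiu418.F0P6aModuliDatumDefs
open Summit.HodgeConjecture.HodgeConjecture.Cruxes.HLiu418.F0P6aRGDAssembly
open Summit.HodgeConjecture.HodgeConjecture.Cruxes.HLiu418.F0P6aDatumOfInputs
section IsogW0OfQuotLeg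
open scoped MonObj CategoryTheory.Obj
variable {F : Type} [Field F] [NumberField F] [IsCMField F] {ι₁ : F →+* ℂ}
    {Jstar : Matrix (Fin 2) (Fin 2) F}
    {K₀ : C5.OpenCompactSubgroup ↥(finAdelic ↥(maximalRealSubfield F) F (IsCMField.complexConj F) 2 Jstar)}
    {S : RecordSystemGS F Jstar ι₁ K₀} {hU7ₛ : S.HeckeTranslateDefinedOver}
    {hJ : (Jstar.map (IsCMField.complexConj F))ᵀ = Jstar} {hJu : IsUnit Jstar}
    {Fi : Type} [Field Fi] [Algebra F Fi] {Kc : C5.SmallLevel K₀} {G : Type} [Group G]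
    {𝓜 : IntegralModel (𝓞 F) F ((thickening F Fi).obj (S.M.obj Kc))}
    {w : HeightOneSpectrum (𝓞 F)} {hw : (IsCMField.complexConj F) • w ≠ w} {h𝓨 : (𝓜.localise w).IsSmoothProper 1}
    {θ : ActionOver (𝓜.localise w).total.hom ((Fi ≃ₐ[F] Fi) × G)}
    {e : Fi →ₐ[F] AlgebraicClosure (w.adicCompletion F)}
variable (I : RGDInputsAt F ι₁ Jstar K₀ S hU7ₛ hJ hJu Fi Kc G 𝓜 w hw h𝓨 θ e) [ExpChar (geomResidueField w) I.pChar]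

set_option maxHeartbeats 400000 in
set_option backward.isDefEq.respectTransparency false in
/-- **`le_ker_isogW₀_of_himg` — THE D6 `QuotQuot₀Law` HYPOTHESIS LETTER FROM THE (IMG) ROW.**  For ANY `φ` with the (LAYER) square and a member `H″ : SubOf I 𝔡 x̄″`: if `ι₀G(x̄) ≫ ψ`
factors ON POINTS through the cover pin over `V(H″)` — `himg : ∀ T (t : T ⟶ G₀(x̄)), ∃ s, s ≫ quotIncl (G₀ x̄″) H″.1 ≫ ι₀G(x̄″) ≫ c̄_{x̄″} = t ≫ ι₀G(x̄) ≫ ψ` (THE (IMG) ROW TEXT for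
(ρ1𝒞) v3) — then `φ` factors through `V(H″) ↪ G₀(x̄″)` AND `H″.1 ≤ RingHom.ker φ.left.appTop.hom` (the hypothesis of the D-LINE՚s `QuotQuot₀Law` at `H′ := H″`).
[cite: Liu2021, Prop. D.8 (2) p. 135, p. 137] [cite: GortzWedhorn2023, (27.1.1) and §(27.2) (p. 607)] -/
theorem le_ker_isogW₀_of_himg [IsCommMonObj I.univ.X]
    {m : ℕ} (E' : Matrix (Fin m) (Fin m) (𝓞 F)) (hE' : E' * E' = E') (P : Matrix (Fin m) (Fin 1) (𝓞 F)) (Q : Matrix (Fin 1) (Fin m) (𝓞 F))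
    (hP : E' * P = P) (hQ : Q * E' = Q) (hQP : Q * P = Matrix.scalar (Fin 1) (I.pChar : 𝓞 F))
    (hPQ : P * Q = Matrix.scalar (Fin m) (I.pChar : 𝓞 F) * E') (h𝔭 : Ideal.span (Set.range fun k => P k 0) = w.asIdeal)
    (𝔡 : ∀ xbar, DockAt I xbar) (xbar xbar'' : AlgPoints (𝓜.localise w).reductionAt (geomResidueField w))
    (ψ : (sch₀Of 𝓜 w I.univ xbar).X ⟶ (sch₀Of 𝓜 w (serreTensor I.act E' hE') xbar'').X)
    (φ : (𝔡 xbar).G₀ ⟶ (𝔡 xbar'').G₀)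
    (hlayer : φ ≫ (𝔡 xbar'').ι₀G ≫
        baseChangeHom (baseChangeHom (serreTranslate I.act E' hE' P) (pullback.fst (𝓜.localise w).total.hom (specResidueField w))) xbar''.left =
      (𝔡 xbar).ι₀G ≫ ψ)
    (H'' : SubOf I 𝔡 xbar'')
    (himg : letI := (𝔡 xbar'').grp₀; haveI := (𝔡 xbar'').aff₀;
      ∀ ⦃T : SchemeOver (geomResidueField w)⦄ (t : T ⟶ (𝔡 xbar).G₀),
        ∃ s : T ⟶ specOver (geomResidueField w) (Alg (𝔡 xbar'').G₀ ⧸ H''.1),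
          s ≫ quotIncl (𝔡 xbar'').G₀ H''.1 ≫ (𝔡 xbar'').ι₀G ≫
              baseChangeHom (baseChangeHom (serreTranslate I.act E' hE' P) (pullback.fst (𝓜.localise w).total.hom (specResidueField w))) xbar''.left =
            t ≫ (𝔡 xbar).ι₀G ≫ ψ) :
    letI := (𝔡 xbar'').grp₀; haveI := (𝔡 xbar'').aff₀;
    (∃ s : (𝔡 xbar).G₀ ⟶ specOver (geomResidueField w) (Alg (𝔡 xbar'').G₀ ⧸ H''.1), s ≫ quotIncl (𝔡 xbar'').G₀ H''.1 = φ) ∧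
      H''.1 ≤ (RingHom.ker φ.left.appTop.hom : Ideal (Alg (𝔡 xbar'').G₀)) := by
  letI := (𝔡 xbar'').grp₀
  haveI := (𝔡 xbar'').aff₀
  haveI : IsClosedImmersion (𝔡 xbar'').ι₀G.left := (𝔡 xbar'').hι₀G.2
  haveI : Mono (𝔡 xbar'').ι₀G := Over.mono_of_mono_left _
  -- (F13) `Exists.elim`, not `obtain`
  refine (Literature.NumberTheory.NumberFields.exists_mem_add_mem_eq_one_of_ne w ((IsCMField.complexConj F) • w) (Ne.symm hw)).elim fun a ha => ha.2.elim fun b hb => ?_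
  refine (exists_returnMap₀_of_mem I E' hE' P Q hP hQ hQP hPQ h𝔭 xbar'' ha.1).elim fun g hg => ?_
  exact le_ker_appTop_of_layer_through_cover ((IsCMField.complexConj F • w).asIdeal)
    (fun x => (((I.act.baseChange (pullback.fst (𝓜.localise w).total.hom (specResidueField w))).baseChange xbar''.left).i x :
      (sch₀Of 𝓜 w I.univ xbar'').X ⟶ (sch₀Of 𝓜 w I.univ xbar'').X))
    (fun x y => RingAction.i_add _ x y) (RingAction.i_one _)
    (𝔡 xbar).ι₀G (𝔡 xbar'').ι₀G (𝔡 xbar'').hkerG₀ ψ _ g hb.2 hb.1 hg.2.1 hlayer H''.1 himg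

end IsogW0OfQuotLeg

end Block_R


/-! §T5 §Tα §D6 continue in PART B `Lines/F0_P6a_SpecOrgansT.lean` (the `ledger crux write` 200 000-byte cap per workfile; LA2-plan (g2) split 09:5xZ 2026-09-02, blocks byte-identical). -/

end Summit.HodgeConjecture.HodgeConjecture.Cruxes.HLiu418.F0P6aLineSpecialisation

end
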